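import Literature.NumberTheory.LFunctions.WeilTwoPrimeCellsT120
import Literature.NumberTheory.LFunctions.WeilTwoPrimeCellsT80NuSplit
import Literature.NumberTheory.LFunctions.WeilTwoPrimeCertificate
import HarnessLib

/-!
# Splitting the moment check of a two-prime certificate over the cell chunks of `[0, 120]`

Topic: `Literature/NumberTheory/LFunctions`. As `WeilTwoPrimeCellsT80NuSplit.lean` for the chain on `[0, 120]`
(`weilTwoPrimeCellsT120 = C0 ++ C1 ++ C2 ++ C3 ++ C4 ++ C5` by definition): one entry `checkNuAt q` of the moment check of a
`WeilCert23` whose cells are `weilTwoPrimeCellsT120` and whose level is `weilTwoPrimeCellsT120Level` follows from the six kernel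
facts `cellsMomentQ₂₃ wL Cᵢ q = vᵢ` and an inequality between literals (**`WeilCert23.checkNuAt_of_partsT120`**). Pure bookkeeping; proved.
-/

namespace Literature.NumberTheory.LFunctions

/-- The cell sum on `[0, 120]` split over the six kernel-sized chunks. [folklore] -/
theorem cellsMomentQ₂₃_T120_split (wL : ℚ) (q : ℕ) :
    cellsMomentQ₂₃ wL weilTwoPrimeCellsT120 q =
      cellsMomentQ₂₃ wL weilTwoPrimeCellsT120C0 q + cellsMomentQ₂₃ wL weilTwoPrimeCellsT120C1 q +
        cellsMomentQ₂₃ wL weilTwoPrimeCellsT120C2 q + cellsMomentQ₂₃ wL weilTwoPrimeCellsT120C3 q +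
        cellsMomentQ₂₃ wL weilTwoPrimeCellsT120C4 q + cellsMomentQ₂₃ wL weilTwoPrimeCellsT120C5 q := by
  simp only [weilTwoPrimeCellsT120, cellsMomentQ₂₃_append, add_assoc]

/-- **One entry of the moment check from the six partial sums** (chain on `[0, 120]`). For a certificate `c` with the cells and
the level of the chain on `[0, 120]`: if the six chunk sums have the values `v₀, …, v₅` and the claimed entry passes
`|ν̃_q − nuScale · a₀^q · 2 (v₀ + ⋯ + v₅)| ≤ 2^{-pnu}`, then `c.checkNuAt q`. [folklore] -/
theorem WeilCert23.checkNuAt_of_partsT120 (c : WeilCert23) (hcells : c.cells = weilTwoPrimeCellsT120)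
    (hwL : c.base.wL = weilTwoPrimeCellsT120Level) (q : ℕ) {v₀ v₁ v₂ v₃ v₄ v₅ : ℚ}
    (h₀ : cellsMomentQ₂₃ weilTwoPrimeCellsT120Level weilTwoPrimeCellsT120C0 q = v₀)
    (h₁ : cellsMomentQ₂₃ weilTwoPrimeCellsT120Level weilTwoPrimeCellsT120C1 q = v₁)
    (h₂ : cellsMomentQ₂₃ weilTwoPrimeCellsT120Level weilTwoPrimeCellsT120C2 q = v₂)
    (h₃ : cellsMomentQ₂₃ weilTwoPrimeCellsT120Level weilTwoPrimeCellsT120C3 q = v₃)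
    (h₄ : cellsMomentQ₂₃ weilTwoPrimeCellsT120Level weilTwoPrimeCellsT120C4 q = v₄)
    (h₅ : cellsMomentQ₂₃ weilTwoPrimeCellsT120Level weilTwoPrimeCellsT120C5 q = v₅)
    (hlit : |getV c.nuData q - nuScale * (c.base.a0 ^ q * (2 * (v₀ + v₁ + v₂ + v₃ + v₄ + v₅)))| ≤ 1 / 2 ^ c.pnu) :
    c.checkNuAt q = true := by
  unfold WeilCert23.checkNuAt WeilCert23.nuQ
  rw [decide_eq_true_eq, hcells, hwL, cellsMomentQ₂₃_T120_split, h₀, h₁, h₂, h₃, h₄, h₅]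
  exact hlit

end Literature.NumberTheory.LFunctions
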